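import Summits.ResolutionOfSingularities.ResolutionOfSingularities.Theorems.PurelyInseparableDim4WinCertLeafSoundFq
import Summits.ResolutionOfSingularities.ResolutionOfSingularities.Theorems.PurelyInseparableDim4WinCertLeafKinds2
import Summits.ResolutionOfSingularities.ResolutionOfSingularities.Theorems.PurelyInseparableDim4ScopeSymmetry
import HarnessLib

/-!
# FCert v3, 𝔽₄ EDITION: a field-generic leaf oracle (substitution / Laurent / GCD leaves) and the DESCENT — a certificate with
# coefficients in `F4` decides the ∀K column for its `𝔽₂`-rational rows over EVERY field of characteristic 2 (cell `res-dim4-pi`)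

[OURS · counted 0 · a certificate format for OUR frame v4, not about resolution] Seat res-dim4-p-8 g4; sequel of
`…WinCertLeafSoundFq` (`forall_inScopeStateWins_of_lwinCertBLF`: res-rescue-typ-3 g9's checker `lwinCertBL N p leafOK` is sound
along every `f : k →+* K` for a finite coefficient field `k`, `|k| = N`).  The located need (res-dim4-typ-3g9, bus 2026-08-29
01:52:28Z (iii)): twelve Fermat/cube-type root-blocked roots of the (2,2) ∀K column need flat absorption at `𝔽₄`-POINTS.  Here:

* §1 **`leafOKG p`** — a leaf oracle GENERIC in the coefficient field `k` (so usable with `k = F4`) on res-dim4-typ-3g9's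
  certificate type `LeafCert4 k` (`…WinCertLeafKinds2`): `subst` (res-dim4-p-8 g3's `substBlindB`, link `substLinkB`), `laurent`
  (p-8 g3's `laurentBlindB`, link `laurentLinkB`), `gcd` (p-8 g4's `gcdLeafB`, link `gcdLinkB`) — all three field-generic — and
  `norm` REJECTED (its certificate `normLeafB` is `𝔽₂`-data by construction; over `F4` a norm leaf is two substitution leaves
  `x_u = ω x_v`, `x_u = ω² x_v`, and the GCD kind covers it as well); **`leafSoundG : LeafSoundF k p (leafOKG p)`** and the `ZMod p`
  reading `leafSoundG_zmod : LeafSound p (leafOKG p)`;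
* §2 **`forall_inScopeStateWins_of_lwinCertBL_F4`** — THE DESCENT: for ANY sound oracle over `F4` and `T : LCert F4 C` with
  `lwinCertBL 4 2 leafOK T = true`, every row whose presented state is the `F4`-cast of an `𝔽₂`-state `s₀` is IN-SCOPE ESCAPABLE
  over EVERY field `K` of characteristic `2`, with or without a primitive cube root of unity: read the certificate in
  `AlgebraicClosure K` along `StepKit.F4.lift β` (`β² + β + 1 = 0`, `ScopeBlind.exists_root_cyclotomic3`), identify the state with
  `s₀ ⊗ K̄ = (s₀ ⊗ K) ⊗ K̄` (`StepKit.SData.map_castHom_eq_map_lift_castF4`), and DESCEND along `K → K̄` with res-dim4-p-14's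
  `ScopeSymmetry.inScopeStateWins_of_inScopeStateWins_map` (in-scope escapability goes DOWN field extensions: B's `K`-replies are
  among its `K̄`-replies, «in scope» and «permissible» are geometric); `_leafOKG` specialisation;
* §3 smoke test by `decide` over `F4`: `leafOKG_cubicLeafF4` (p-8 g4's cubic-cylinder GCD leaf re-read in `F4`) + `cubicLeafF4_children_blind`.
Data files then read: `theorem … : lwinCertBL 4 2 (leafOKG 2) T = true := by decide` (rows over `StepKit.F4`, the root row
`s₀.castF4`), `forall_inScopeStateWins_of_lwinCertBL_F4_leafOKG … ⟨row, hrow, rfl⟩ K`.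
Nothing here proves resolution of singularities in dimension ≥ 4 / characteristic `p`; F4-C(2,2) stays OPEN; the column this
feeds certifies `InScopeStateWins` on listed roots only.  Counted 0; AI work, weaker than expert review.
bears_on: LADDER-RESOLUTION:D157-DOOR2 (res-dim4-pi · F4-C ∀K column · FCert v3, 𝔽₄ edition).
Supports stmt-ResolutionOfSingularities-16155 (helper).
-/

set_option linter.dupNamespace false -- mandated namespace of this single-conjunct summit

noncomputable section
open MvPolynomial Finset
open scoped BigOperators
namespace Summit.ResolutionOfSingularities.ResolutionOfSingularities.Theorems.PIDim4

namespace WinCertLeaf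

open Literature.AlgebraicGeometry.Resolution
open Literature.AlgebraicGeometry.Resolution.CentreBlowup
open StepKit WinCertSound InScopeWinCert ScopeCover ScopeBlind WinCertAllFields WinCertFlat WinCertSubst

/-! ## 1. A field-generic leaf oracle on `LeafCert4 k`: substitution, Laurent and GCD leaves -/

variable {k : Type} [Field k] [DecidableEq k]

/-- **THE FIELD-GENERIC LEAF ORACLE** (any coefficient field `k`, any `p`) on res-dim4-typ-3g9's `LeafCert4 k`: the syntactic
link and the kind's Boolean certificate on the chart of the leaf for `subst` / `laurent` / `gcd`; `norm` is rejected (its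
certificate is `𝔽₂`-data). [folklore] -/
def leafOKG (p : ℕ) (s : SData 4 k) (S : Finset (Fin 4)) (ℓ : ILeaf k (LeafCert4 k)) : Bool :=
  match ℓ.cert with
  | .subst σ T α₀ => ℓ.opens.isEmpty && substLinkB ℓ σ && substBlindB p (chartL p S ℓ.j s.L) σ T α₀
  | .norm _ _ _ _ => false
  | .laurent T m aL cL cert α₀ => laurentLinkB ℓ T m aL cL && laurentBlindB p (chartL p S ℓ.j s.L) T m aL cL cert α₀
  | .gcd T h cof bez α₀ => gcdLinkB ℓ T h && gcdLeafB p (chartL p S ℓ.j s.L) T h cof bez α₀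

/-- **SOUNDNESS OF THE GENERIC ORACLE** along every `f : k →+* K`: `leafOKG p` is a sound leaf oracle (res-dim4-p-8's
`not_inCoordinateScope_step_map_of_substBlindB` / `…_of_laurentBlindB` / `…_of_gcdLeafB`, res-dim4-typ-3g9's links). [folklore] -/
theorem leafSoundG (p : ℕ) [Fact p.Prime] : LeafSoundF k p (leafOKG (k := k) p) := by
  classical
  intro s S ℓ hok K _ _ _ f b hbj hon
  obtain ⟨j, gens, opens, cert⟩ := ℓ
  cases cert with
  | subst σ T α₀ =>
    simp only [leafOKG, Bool.and_eq_true] at hok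
    obtain ⟨⟨-, hlink⟩, hsub⟩ := hok
    exact not_inCoordinateScope_step_map_of_substBlindB hsub K f b (eval_map_eq_of_substLinkB f hlink hbj hon)
  | norm T u v α₀ =>
    simp only [leafOKG] at hok
    exact absurd hok Bool.false_ne_true
  | laurent T m aL cL cert α₀ =>
    simp only [leafOKG, Bool.and_eq_true] at hok
    obtain ⟨hlink, hlau⟩ := hok
    obtain ⟨hT, hab, hZ⟩ := laurent_hyps_of_linkB f hlink hbj hon
    exact not_inCoordinateScope_step_map_of_laurentBlindB hlau K f b hT hab hZ
  | gcd T h cof bez α₀ =>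
    simp only [leafOKG, Bool.and_eq_true] at hok
    obtain ⟨hlink, hg⟩ := hok
    obtain ⟨hT, hh⟩ := gcd_hyps_of_linkB f hlink hbj hon
    exact not_inCoordinateScope_step_map_of_gcdLeafB hg K f b hT hh

/-- the same oracle read over `ZMod p` is a sound oracle in res-rescue-typ-3 g9's sense (`𝔽_p`-data files may use `leafOKG p` with
`forall_inScopeStateWins_of_lwinCertBL`). [folklore] -/
theorem leafSoundG_zmod (p : ℕ) [Fact p.Prime] : LeafSound p (leafOKG (k := ZMod p) p) :=
  fun s S ℓ hok K _ _ _ f b hbj hon => leafSoundG (k := ZMod p) p s S ℓ hok K f b hbj hon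

/-! ## 2. The descent: `F4`-certificates decide the ∀K column for their `𝔽₂`-rational rows -/

/-- **𝔽₄ CERTIFICATES OVER EVERY FIELD OF CHARACTERISTIC 2.**  Let `leafOK` be a sound leaf oracle over `F4` and `T : LCert F4 C`
pass `lwinCertBL 4 2 leafOK` (cover witnesses `x_i⁴ − x_i`).  Then every row whose presented state is the `F4`-cast of an
`𝔽₂`-state `s₀` is IN-SCOPE ESCAPABLE over EVERY field `K` of characteristic `2` (player B ranging over all of `K⁴`): certificate
read in `K̄ = AlgebraicClosure K` along `F4.lift β`, then descent `K̄ ↝ K`. OURS. [folklore] -/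
theorem forall_inScopeStateWins_of_lwinCertBL_F4 {C : Type} {leafOK : SData 4 F4 → Finset (Fin 4) → ILeaf F4 C → Bool}
    (hs : LeafSoundF F4 2 leafOK) {T : LCert F4 C} (h : lwinCertBL 4 2 leafOK T = true) {s₀ : SData 4 (ZMod 2)}
    (hrow : ∃ row ∈ T, row.1.1 = s₀.castF4) (K : Type) [Field K] [CharP K 2] [DecidableEq K] :
    InScopeStateWins 2
      (⟨MvPolynomial.map (ZMod.castHom (dvd_refl 2) K) s₀.toState.F, s₀.toState.r, s₀.toState.exc⟩ : State K) := by
  classical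
  let Kb : Type := AlgebraicClosure K
  let g : K →+* Kb := algebraMap K Kb
  obtain ⟨β, hβ⟩ := ScopeBlind.exists_root_cyclotomic3 Kb
  obtain ⟨row, hrowT, hrow0⟩ := hrow
  have hw := forall_inScopeStateWins_of_lwinCertBLF F4.card_F4 hs h Kb (F4.lift β hβ) row hrowT
  rw [hrow0, ← SData.map_castHom_eq_map_lift_castF4 s₀ β hβ, SData.castF4_toState_r, SData.castF4_toState_exc] at hw
  refine ScopeSymmetry.inScopeStateWins_of_inScopeStateWins_map g 2 ?_
  have e3 : MvPolynomial.map g (MvPolynomial.map (ZMod.castHom (dvd_refl 2) K) s₀.toState.F) =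
      MvPolynomial.map (ZMod.castHom (dvd_refl 2) Kb) s₀.toState.F := by
    rw [MvPolynomial.map_map, show g.comp (ZMod.castHom (dvd_refl 2) K) = ZMod.castHom (dvd_refl 2) Kb from Subsingleton.elim _ _]
  show InScopeStateWins 2
    (⟨MvPolynomial.map g (MvPolynomial.map (ZMod.castHom (dvd_refl 2) K) s₀.toState.F), s₀.toState.r, s₀.toState.exc⟩ : State Kb)
  rw [e3]
  exact hw

/-- **… with the generic oracle**: `lwinCertBL 4 2 (leafOKG 2) T = true` (one `decide` over `StepKit.F4`) ⟹ every `𝔽₂`-rational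
row is in-scope escapable over every field of characteristic `2`. OURS. [folklore] -/
theorem forall_inScopeStateWins_of_lwinCertBL_F4_leafOKG {T : LCert F4 (LeafCert4 F4)} (h : lwinCertBL 4 2 (leafOKG 2) T = true)
    {s₀ : SData 4 (ZMod 2)} (hrow : ∃ row ∈ T, row.1.1 = s₀.castF4) (K : Type) [Field K] [CharP K 2] [DecidableEq K] :
    InScopeStateWins 2
      (⟨MvPolynomial.map (ZMod.castHom (dvd_refl 2) K) s₀.toState.F, s₀.toState.r, s₀.toState.exc⟩ : State K) :=
  forall_inScopeStateWins_of_lwinCertBL_F4 (leafSoundG (k := F4) 2) h hrow K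

/-- **… and for rows over `F4` themselves, over every field CONTAINING a primitive cube root of unity** (`β² + β + 1 = 0`), along
`F4.lift β`: the plain `∀ K ⊇ 𝔽₄` reading. OURS. [folklore] -/
theorem forall_inScopeStateWins_of_lwinCertBL_F4_lift {C : Type} {leafOK : SData 4 F4 → Finset (Fin 4) → ILeaf F4 C → Bool}
    (hs : LeafSoundF F4 2 leafOK) {T : LCert F4 C} (h : lwinCertBL 4 2 leafOK T = true) (K : Type) [Field K] [CharP K 2]
    [DecidableEq K] (β : K) (hβ : β ^ 2 + β + 1 = 0) :
    ∀ row ∈ T, InScopeStateWins 2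
      (⟨MvPolynomial.map (F4.lift β hβ) row.1.1.toState.F, row.1.1.toState.r, row.1.1.toState.exc⟩ : State K) :=
  forall_inScopeStateWins_of_lwinCertBLF F4.card_F4 hs h K (F4.lift β hβ)

/-! ## 3. Smoke test: the generic oracle evaluates over `StepKit.F4` by `decide` -/

/-- p-8 g4's cubic-cylinder GCD leaf (`ScopeBlind.cubicSpec`: root `x₃x₄² + x₃²x₄ + x₂x₄³`, centre `V(z, x₁, x₃, x₄)`, chart `x₃`,
`T = {x₃}`, `h = x₂x₄² + x₄ + 1`), re-read with coefficients in `F4`, as an FCert-v3 implicit leaf. [OURS · specimen] -/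
def cubicLeafF4 : ILeaf F4 (LeafCert4 F4) :=
  ⟨2, [[(![0, 1, 0, 2], 1), (![0, 0, 0, 1], 1), (![0, 0, 0, 0], 1)]], [],
    .gcd {2} [(![0, 1, 0, 2], 1), (![0, 0, 0, 1], 1), (![0, 0, 0, 0], 1)]
      (fun α => if α = ![0, 0, 1, 0] then [(![0, 0, 0, 1], 1)] else [])
      ![[(![0, 0, 0, 0], [(![0, 0, 0, 0], 1)])], [(![0, 0, 0, 0], [(![0, 0, 0, 0], 1)])], [],
        [(![0, 1, 0, 0], [(![0, 0, 0, 0], 1)]), (![0, 0, 0, 0], [(![0, 0, 0, 1], 1), (![0, 0, 0, 0], 1)])]]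
      ![0, 0, 1, 0]⟩

/-- the generic oracle accepts it on the `F4`-cast state (kernel evaluation of `gcdLeafB` over `F4`). [OURS · ‖ K] -/
theorem leafOKG_cubicLeafF4 : leafOKG 2 ScopeBlind.cubicSpec.castF4 {0, 2, 3} cubicLeafF4 = true := by
  decide

/-- hence (through `leafSoundG`) over every field `K ∋ ω` of characteristic `2`, along `F4.lift`, at every `b` with `b₃ = 0` on the
cubic cylinder, the child is blind — the `F4`-coefficient twin of `ScopeBlind.cubicSpec_children_blind`. [OURS · ‖ K] -/
theorem cubicLeafF4_children_blind (K : Type) [Field K] [CharP K 2] [DecidableEq K] (β : K) (hβ : β ^ 2 + β + 1 = 0)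
    (b : Fin 4 → K) (hb3 : b 2 = 0) (hon : OnLeaf (F4.lift β hβ) cubicLeafF4 b) :
    ¬ InCoordinateScope 2
      (CentreBlowup.step 2 {0, 2, 3} 2 b
        (⟨MvPolynomial.map (F4.lift β hβ) ScopeBlind.cubicSpec.castF4.toState.F, ScopeBlind.cubicSpec.castF4.toState.r,
          ScopeBlind.cubicSpec.castF4.toState.exc⟩ : State K)).F :=
  leafSoundG (k := F4) 2 _ _ _ leafOKG_cubicLeafF4 K (F4.lift β hβ) b hb3 hon


end WinCertLeaf

end Summit.ResolutionOfSingularities.ResolutionOfSingularities.Theorems.PIDim4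

end
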